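import Literature.Barriers.AtomisticToContinuum.DisorderedHarmonicChainTVBound
import Literature.Barriers.AtomisticToContinuum.DisorderedHarmonicChainSmoothing
import Literature.Barriers.AtomisticToContinuum.DisorderedHarmonicChainCLT
import Literature.Barriers.AtomisticToContinuum.DisorderedHarmonicChainUniformStart
import Literature.Barriers.AtomisticToContinuum.DisorderedHarmonicChainApproxKernelsFactors
import Literature.Barriers.AtomisticToContinuum.DisorderedHarmonicChainPotentialUpper
import HarnessLib

/-!
# Ajanki–Huveneers 2011, Prop. 5.1: the lower bound (5.2) for `h ≡ 0` (continuous test functions)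

We PROVE the lower bound (5.2) of Prop. 5.1 of O. Ajanki, F. Huveneers, CMP **301** (2011)
841–883 (arXiv:1003.1076) for the untilted chain: there are `K', w₀ > 0` with
`𝔼 u(X^x_n) ≥ K' ∫_𝕋 u` for `0 < w ≤ w₀`, every continuous `1`-periodic `u ≥ 0`, every start `x`
and `1/2 ≤ w²n ≤ 1` (`potential_lower_continuous`). This is the only instance of (5.2) used in
§6.1 of the paper (`…ResonantSet.lean`, `h ≡ 0`).

The paper's Step 1 rests on the misprinted Lemma 5.3 (refuted in `…RyCounterexample.lean`); our
route: split `n = n₂ + n₁` (Markov property, `markov_split`), `F(y) = 𝔼_y u(X_{n₂})` is continuous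
`1`-periodic with `0 ≤ F ≤ 2√2 K ∫_𝕋 u` (upper bound (5.1), `density_upper_continuous`) and
`∫_0^1 F ≥ e^{-2C} ∫_0^1 u` (`uniform_start_lower`); the law of `X^x_{n₁}` is almost translation
invariant (`translation_bound`) and its low Fourier coefficients are Gaussian up to `𝒪(w)`
(`clt_low_frequency`), so Fejér smoothing (`smoothing_lower_bound`) gives
`𝔼 F(X^x_{n₁}) ≥ (g/2)·e^{-2C} ∫ u - o(1) ∫ u`.

[cite: AjankiHuveneers2011, Prop. 5.1 eq. (5.2)]
-/

noncomputable section

open Real MeasureTheory Set Filter Function Finset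
open scoped ENNReal NNReal

namespace Literature.Barriers.AtomisticToContinuum.HeatConduction

variable {τ : ℝ → ℝ} {bm bp : ℝ}

/-! ### Elementary inequalities -/

/-- `(1 - t)ⁿ ≥ e^{-2tn}` for `0 ≤ t ≤ 1/2`. [folklore] -/
theorem exp_neg_le_one_sub_pow {t : ℝ} (h0 : 0 ≤ t) (h1 : t ≤ 1 / 2) (n : ℕ) :
    Real.exp (-(2 * t * n)) ≤ (1 - t) ^ n := by
  have hstep : Real.exp (-(2 * t)) ≤ 1 - t := by
    have h2 := Real.add_one_le_exp (2 * t)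
    have h3 : Real.exp (-(2 * t)) * Real.exp (2 * t) = 1 := by rw [← Real.exp_add]; simp
    have h4 : 0 < Real.exp (2 * t) := Real.exp_pos _
    have h5 : Real.exp (-(2 * t)) ≤ 1 / (1 + 2 * t) := by
      rw [le_div_iff₀ (by linarith)]; nlinarith [Real.exp_pos (-(2 * t))]
    have h6 : 1 / (1 + 2 * t) ≤ 1 - t := by
      rw [div_le_iff₀ (by linarith)]; nlinarith
    linarith
  calc Real.exp (-(2 * t * n)) = Real.exp (-(2 * t)) ^ n := by rw [← Real.exp_nat_mul]; ring_nf
    _ ≤ (1 - t) ^ n := pow_le_pow_left₀ (Real.exp_pos _).le hstep n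

/-- `e^{-c/w}/w ≤ 2w/c²` for `c, w > 0`. [folklore] -/
theorem exp_neg_div_div_le {c w : ℝ} (hc : 0 < c) (hw : 0 < w) : Real.exp (-(c / w)) / w ≤ 2 * w / c ^ 2 := by
  have h1 := Real.quadratic_le_exp_of_nonneg (x := c / w) (by positivity)
  have h2 : (c / w) ^ 2 / 2 ≤ Real.exp (c / w) := by
    have : 0 ≤ 1 + c / w := by positivity
    linarith
  rw [Real.exp_neg, div_le_div_iff₀ hw (by positivity)]
  rw [div_pow] at h2
  have h3 : c ^ 2 / w ^ 2 / 2 * (2 * w * w) = c ^ 2 := by field_simp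
  calc (Real.exp (c / w))⁻¹ * c ^ 2 = (Real.exp (c / w))⁻¹ * (c ^ 2 / w ^ 2 / 2 * (2 * w * w)) := by rw [h3]
    _ ≤ (Real.exp (c / w))⁻¹ * (Real.exp (c / w) * (2 * w * w)) := by
        refine mul_le_mul_of_nonneg_left (mul_le_mul_of_nonneg_right h2 (by positivity)) (by positivity)
    _ = 2 * w * w := by rw [← mul_assoc, inv_mul_cancel₀ (Real.exp_pos _).ne', one_mul]

/-- Monotone lower bound of the Gaussian constant on a variance window. [folklore] -/
theorem gaussLower_ge {V : ℝ≥0} {Vm Vp : ℝ} (hVm : 0 < Vm) (h1 : Vm ≤ (V : ℝ)) (h2 : (V : ℝ) ≤ Vp) :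
    (Real.sqrt (2 * π * Vp))⁻¹ * Real.exp (-(9 / (8 * Vm))) ≤ gaussLower V := by
  unfold gaussLower
  have hV : 0 < (V : ℝ) := hVm.trans_le h1
  have hVp : 0 < Vp := hV.trans_le h2
  refine mul_le_mul ?_ ?_ (Real.exp_pos _).le (by positivity)
  · rw [inv_le_inv₀ (Real.sqrt_pos.mpr (by positivity)) (Real.sqrt_pos.mpr (by positivity))]
    exact Real.sqrt_le_sqrt (by nlinarith [Real.pi_pos])
  · rw [Real.exp_le_exp, neg_le_neg_iff]
    exact div_le_div_of_nonneg_left (by norm_num) (by positivity) (by nlinarith)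

/-! ### The Markov property: `𝔼_x u(X_{n₂+n₁}) = 𝔼_x F(X_{n₁})`, `F(y) = 𝔼_y u(X_{n₂})` -/

/-- `(y, B) ↦ X^y_k(B)` is jointly measurable. [folklore] -/
theorem measurable_ahPhase_uncurry (w : ℝ) {n : ℕ} :
    ∀ k, Measurable fun p : ℝ × (Fin n → ℝ) => ahPhase w p.1 (finExt p.2) k
  | 0 => measurable_fst
  | k + 1 => by
    have : (fun p : ℝ × (Fin n → ℝ) => ahPhase w p.1 (finExt p.2) (k + 1)) =
        (fun q : ℝ × ℝ => ahStep w q.2 q.1) ∘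
          fun p => (ahPhase w p.1 (finExt p.2) k, finExt p.2 k) := rfl
    rw [this]
    exact (measurable_ahStep₂ w).comp ((measurable_ahPhase_uncurry w k).prodMk ((measurable_finExt k).comp measurable_snd))

/-- `F(y) = 𝔼_y u(X_n)` is measurable for bounded measurable `u`. [folklore] -/
theorem measurable_expect (ρB : Measure ℝ) [IsProbabilityMeasure ρB] {u : ℝ → ℝ} (hum : Measurable u)
    (w : ℝ) (n : ℕ) : Measurable fun y => ∫ B, u (ahPhase w y (finExt B) n) ∂(Measure.pi fun _ : Fin n => ρB) := by
  have h : StronglyMeasurable (Function.uncurry fun (y : ℝ) (B : Fin n → ℝ) => u (ahPhase w y (finExt B) n)) :=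
    (hum.comp (measurable_ahPhase_uncurry w n)).stronglyMeasurable
  exact (h.integral_prod_right' (ν := Measure.pi fun _ : Fin n => ρB)).measurable

/-- **Markov property of the phase chain** (bounded measurable `u`):
`𝔼_x u(X_{n₂+n₁}) = 𝔼_x F(X_{n₁})` with `F(y) = 𝔼_y u(X_{n₂})`. [cite: AjankiHuveneers2011, §5 eq. (5.3) (`T^{n₂+n₁} = T^{n₁}T^{n₂}`)] -/
theorem markov_split (ρB : Measure ℝ) [IsProbabilityMeasure ρB] {u : ℝ → ℝ} (hum : Measurable u) {M : ℝ}
    (huM : ∀ y, |u y| ≤ M) (w : ℝ) (n₂ : ℕ) :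
    ∀ (n₁ : ℕ) (x : ℝ), ∫ B, u (ahPhase w x (finExt B) (n₂ + n₁)) ∂(Measure.pi fun _ : Fin (n₂ + n₁) => ρB) =
      ∫ B, (fun y => ∫ B', u (ahPhase w y (finExt B') n₂) ∂(Measure.pi fun _ : Fin n₂ => ρB))
        (ahPhase w x (finExt B) n₁) ∂(Measure.pi fun _ : Fin n₁ => ρB)
  | 0, x => by simp
  | n₁ + 1, x => by
    set F : ℝ → ℝ := fun y => ∫ B', u (ahPhase w y (finExt B') n₂) ∂(Measure.pi fun _ : Fin n₂ => ρB) with hF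
    have hM0 : 0 ≤ M := (abs_nonneg _).trans (huM 0)
    have hFm : Measurable F := measurable_expect ρB hum w n₂
    have hFb : ∀ y, |F y| ≤ M := fun y => by
      simp only [hF]
      have := norm_integral_le_of_norm_le_const (μ := Measure.pi fun _ : Fin n₂ => ρB)
        (f := fun B' => u (ahPhase w y (finExt B') n₂)) (C := M) (ae_of_all _ fun B' => by
          rw [Real.norm_eq_abs]; exact huM _)
      rw [Real.norm_eq_abs] at this; simpa using this
    -- left-hand side: peel the first mass
    have hI1 : Integrable (fun B : Fin (n₂ + n₁ + 1) → ℝ => u (ahPhase w x (finExt B) (n₂ + n₁ + 1)))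
        (Measure.pi fun _ : Fin (n₂ + n₁ + 1) => ρB) :=
      Integrable.mono' (integrable_const M) ((hum.comp (measurable_ahPhase_pi w x _)).aestronglyMeasurable)
        (ae_of_all _ fun B => by rw [Real.norm_eq_abs]; exact huM _)
    have hI2 : Integrable (fun B : Fin (n₁ + 1) → ℝ => F (ahPhase w x (finExt B) (n₁ + 1)))
        (Measure.pi fun _ : Fin (n₁ + 1) => ρB) :=
      Integrable.mono' (integrable_const M) ((hFm.comp (measurable_ahPhase_pi w x _)).aestronglyMeasurable)
        (ae_of_all _ fun B => by rw [Real.norm_eq_abs]; exact hFb _)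
    rw [show n₂ + (n₁ + 1) = n₂ + n₁ + 1 from rfl, integral_pi_succ_cons ρB (n₂ + n₁) hI1,
      integral_pi_succ_cons ρB n₁ hI2]
    refine integral_congr_ae (ae_of_all _ fun b => ?_)
    simp only [ahPhase_finExt_cons]
    exact markov_split ρB hum huM w n₂ n₁ (ahStep w b x)

/-- `F(y) = 𝔼_y u(X_n)` is continuous, `1`-periodic and `0 ≤ F ≤ sup u` for continuous `1`-periodic
`u ≥ 0`, in the small-`w` regime. [folklore] -/
theorem expect_continuous (hτ : ReducedLawHyp τ bm bp) {ρB : Measure ℝ} [IsProbabilityMeasure ρB]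
    (hρ : ρB = volume.withDensity fun s => ENNReal.ofReal (τ s)) {w : ℝ} (hw0 : 0 < w)
    (hwb : w ≤ pcW (max |bm| |bp|)) {u : ℝ → ℝ} (huc : Continuous u) (huper : Function.Periodic u 1)
    (n : ℕ) :
    Continuous (fun y => ∫ B, u (ahPhase w y (finExt B) n) ∂(Measure.pi fun _ : Fin n => ρB)) ∧
      Function.Periodic (fun y => ∫ B, u (ahPhase w y (finExt B) n) ∂(Measure.pi fun _ : Fin n => ρB)) 1 := by
  set bstar : ℝ := max |bm| |bp| with hbstar
  have hbstar0 : 0 ≤ bstar := le_max_of_le_left (abs_nonneg _)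
  obtain ⟨M, hM0, hM⟩ := exists_bound_of_periodic' huc huper
  set μn := (Measure.pi fun _ : Fin n => ρB) with hμn
  obtain ⟨hw2, -, -⟩ := pc_small hbstar0 hw0.le hwb (show |(0:ℝ)| ≤ bstar by rw [abs_zero]; exact hbstar0)
  have hwπ : π * w / 2 < 1 := by linarith
  have hcube : ∀ᵐ B ∂μn, ∀ k, |igDelta w (finExt B k)| < 1 := by
    filter_upwards [ae_pi_cube hτ hρ n] with B hB k
    have hk : finExt B k ∈ Set.Icc bm bp := by
      by_cases h : k < n
      · rw [finExt_of_lt _ h]; exact ⟨(hB _).1, (hB _).2⟩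
      · simp only [finExt, h, ↓reduceDIte]; exact ⟨hτ.bm_nonpos, hτ.bp_nonneg⟩
    obtain ⟨-, -, hδ⟩ := pc_small hbstar0 hw0.le hwb (ReducedLawHyp.abs_le_of_mem hk)
    linarith [hδ]
  have hmeasU : ∀ y, AEStronglyMeasurable (fun B : Fin n → ℝ => u (ahPhase w y (finExt B) n)) μn := fun y =>
    (huc.measurable.comp (measurable_ahPhase_pi w y n)).aestronglyMeasurable
  constructor
  · refine continuous_of_dominated (F := fun y B => u (ahPhase w y (finExt B) n)) (bound := fun _ => M)
      (fun y => hmeasU y) (fun y => ae_of_all _ fun B => ?_) (integrable_const M) ?_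
    · rw [Real.norm_eq_abs]; exact hM _
    · filter_upwards [hcube] with B hB
      exact huc.comp (continuous_ahPhase_start hw0.le hwπ hB n)
  · intro y
    refine integral_congr_ae (ae_of_all _ fun B => ?_)
    show u (ahPhase w (y + 1) (finExt B) n) = u (ahPhase w y (finExt B) n)
    rw [ahPhase_add_one, huper]

/-! ### The lower bound (5.2) for `h ≡ 0` and continuous test functions -/

set_option maxHeartbeats 3200000 in
/-- **Prop. 5.1, lower bound (5.2), `h ≡ 0`, continuous test functions**: there are `K', w₀ > 0`
such that for `0 < w ≤ w₀`, every continuous `1`-periodic `u ≥ 0`, every `x` and every `n` with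
`1/2 ≤ w²n ≤ 1`: `K' ∫_{[0,1)} u ≤ 𝔼 u(X^x_n)`. [cite: AjankiHuveneers2011, Prop. 5.1 eq. (5.2)] -/
theorem potential_lower_continuous (hτ : ReducedLawHyp τ bm bp) (ρB : Measure ℝ) [IsProbabilityMeasure ρB]
    (hρ : ρB = volume.withDensity fun s => ENNReal.ofReal (τ s)) :
    ∃ K' w₀ : ℝ, 0 < K' ∧ 0 < w₀ ∧ ∀ w ∈ Set.Ioc 0 w₀,
      ∀ u : ℝ → ℝ, Continuous u → Function.Periodic u 1 → (∀ y, 0 ≤ u y) → ∀ x : ℝ, ∀ n : ℕ,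
        1 / 2 ≤ w ^ 2 * n → w ^ 2 * n ≤ 1 →
          K' * ∫ y in Set.Ico (0:ℝ) 1, u y ≤ ∫ B, u (ahPhase w x (finExt B) n) ∂(Measure.pi fun _ : Fin n => ρB) := by
  set bstar : ℝ := max |bm| |bp| with hbstar
  have hbstar0 : 0 ≤ bstar := le_max_of_le_left (abs_nonneg _)
  have hκ8 : (0:ℝ) < 1 / 8 := by norm_num
  -- the four inputs
  obtain ⟨Ku, wu, hKu, hwu, hup⟩ := density_upper_continuous hτ ρB hρ hκ8 (h := fun _ => (0:ℝ)) (fun _ => rfl) contDiff_const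
  obtain ⟨C₁, c, wt, hC₁, hc, hwt, htr⟩ := translation_bound hτ ρB hρ hκ8
  obtain ⟨ws, hws, Cs, hCs0, hCsw, hus⟩ := uniform_start_lower hτ ρB hρ
  set σ2 : ℝ := bM2 ρB with hσ2
  have hσ : 0 < σ2 := by
    have : σ2 = ∫ b, b ^ 2 * τ b := by rw [hσ2]; unfold bM2; exact integral_rhoB hτ hρ _
    rw [this]; exact hτ.variance_pos
  -- constants
  set Vm : ℝ := 3 / 64 * σ2 with hVm
  set Vp : ℝ := 3 / 16 * σ2 with hVp
  have hVm0 : 0 < Vm := by positivity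
  set gm : ℝ := (Real.sqrt (2 * π * Vp))⁻¹ * Real.exp (-(9 / (8 * Vm))) with hgm
  have hgm0 : 0 < gm := by positivity
  set r : ℝ := Real.exp (-(2 * Cs)) with hr
  have hr0 : 0 < r := Real.exp_pos _
  set A₀ : ℝ := 2 * Real.sqrt 2 * Ku with hA₀
  have hA₀0 : 0 < A₀ := by positivity
  set C₁' : ℝ := 2 * Real.sqrt 2 * C₁ with hC₁'
  have hC₁'0 : 0 < C₁' := by positivity
  set m : ℕ := ⌈(16 * A₀ * C₁' / (gm * r)) ^ 2⌉₊ + 1 with hmdef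
  have hm0 : 0 < m := Nat.succ_pos _
  have hmr : (16 * A₀ * C₁' / (gm * r)) ^ 2 ≤ m := by
    rw [hmdef]; push_cast
    exact (Nat.le_ceil _).trans (le_add_of_nonneg_right zero_le_one)
  have hsqm : 16 * A₀ * C₁' / (gm * r) ≤ Real.sqrt m := by
    rw [← Real.sqrt_sq (by positivity : (0:ℝ) ≤ 16 * A₀ * C₁' / (gm * r))]
    exact Real.sqrt_le_sqrt hmr
  have hmpos : (0:ℝ) < m := by exact_mod_cast hm0
  have hsqm0 : 0 < Real.sqrt m := Real.sqrt_pos.mpr hmpos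
  have hbm : A₀ * (C₁' / Real.sqrt m) ≤ gm * r / 16 := by
    rw [mul_div_assoc', div_le_iff₀ hsqm0]
    have := mul_le_mul_of_nonneg_left hsqm (by positivity : (0:ℝ) ≤ gm * r / 16)
    have e : gm * r / 16 * (16 * A₀ * C₁' / (gm * r)) = A₀ * C₁' := by field_simp
    linarith
  obtain ⟨Cc, wc, hwc, hclt⟩ := clt_low_frequency hτ ρB hρ (Θ := 2 * π * m) (by positivity)
  set Cc' : ℝ := |Cc| with hCc'
  have hCc'0 : 0 ≤ Cc' := abs_nonneg _
  set wa : ℝ := gm * r / (32 * m * Cc' * A₀ + 1) with hwa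
  set wb : ℝ := gm * r * c ^ 2 / (32 * A₀ * C₁ + 1) with hwbdef
  have hwa0 : 0 < wa := by positivity
  have hwb0 : 0 < wb := by positivity
  set w₀ : ℝ := min (min (min wu wt) (min ws wc)) (min (min (1 / 2) (pcW bstar)) (min wa wb)) with hw₀
  have hw₀0 : 0 < w₀ := by
    rw [hw₀]
    exact lt_min (lt_min (lt_min hwu hwt) (lt_min hws hwc)) (lt_min (lt_min (by norm_num) (pcW_pos hbstar0)) (lt_min hwa0 hwb0))
  refine ⟨gm * r / 4, w₀, by positivity, hw₀0, ?_⟩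
  intro w hw u huc huper hu0 x n hn1 hn2
  obtain ⟨hw0, hwle⟩ := hw
  have hL : w₀ ≤ min (min wu wt) (min ws wc) := min_le_left _ _
  have hR : w₀ ≤ min (min (1 / 2) (pcW bstar)) (min wa wb) := min_le_right _ _
  have hwwu : w ∈ Set.Ioc 0 wu := ⟨hw0, hwle.trans (hL.trans ((min_le_left _ _).trans (min_le_left _ _)))⟩
  have hwwt : w ∈ Set.Ioc 0 wt := ⟨hw0, hwle.trans (hL.trans ((min_le_left _ _).trans (min_le_right _ _)))⟩
  have hwws : w ∈ Set.Ioc 0 ws := ⟨hw0, hwle.trans (hL.trans ((min_le_right _ _).trans (min_le_left _ _)))⟩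
  have hwwc : w ∈ Set.Ioc 0 wc := ⟨hw0, hwle.trans (hL.trans ((min_le_right _ _).trans (min_le_right _ _)))⟩
  have hw12 : w ≤ 1 / 2 := hwle.trans (hR.trans ((min_le_left _ _).trans (min_le_left _ _)))
  have hwpc : w ≤ pcW bstar := hwle.trans (hR.trans ((min_le_left _ _).trans (min_le_right _ _)))
  have hwwa : w ≤ wa := hwle.trans (hR.trans ((min_le_right _ _).trans (min_le_left _ _)))
  have hwwb : w ≤ wb := hwle.trans (hR.trans ((min_le_right _ _).trans (min_le_right _ _)))
  have hw1 : w ≤ 1 := by linarith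
  -- the time split `n = n₂ + n₁`
  obtain ⟨n₁, n₂, hn, hlo, hhi⟩ : ∃ n₁ n₂ : ℕ, n = n₂ + n₁ ∧ 2 * n₁ ≤ n ∧ n ≤ 2 * n₁ + 1 :=
    ⟨n / 2, n - n / 2, by omega, by omega, by omega⟩
  have hn₂lo : n₁ ≤ n₂ := by omega
  have hn₂hi : n₂ ≤ n₁ + 1 := by omega
  subst hn
  have hlo' : 2 * (n₁ : ℝ) ≤ (n₂ + n₁ : ℕ) := by exact_mod_cast hlo
  have hhi' : ((n₂ + n₁ : ℕ) : ℝ) ≤ 2 * n₁ + 1 := by exact_mod_cast hhi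
  have hn₂lo' : (n₁ : ℝ) ≤ n₂ := by exact_mod_cast hn₂lo
  have hn₂hi' : (n₂ : ℝ) ≤ n₁ + 1 := by exact_mod_cast hn₂hi
  have hw2 : w ^ 2 ≤ 1 / 4 := by
    have := mul_le_mul hw12 hw12 hw0.le (by norm_num)
    nlinarith only [this]
  have hw20 : 0 ≤ w ^ 2 := sq_nonneg w
  have hN : ((n₂ + n₁ : ℕ) : ℝ) = (n₂ : ℝ) + n₁ := by push_cast; ring
  rw [hN] at hn1 hn2 hlo' hhi'
  have hn₁0 : (0:ℝ) ≤ n₁ := Nat.cast_nonneg n₁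
  have hn₂0 : (0:ℝ) ≤ n₂ := Nat.cast_nonneg n₂
  have a1 := mul_le_mul_of_nonneg_left hhi' hw20
  have a2 := mul_le_mul_of_nonneg_left hlo' hw20
  have a3 := mul_le_mul_of_nonneg_left hn₂lo' hw20
  have a4 := mul_le_mul_of_nonneg_left hn₂hi' hw20
  have e1 : w ^ 2 * (2 * (n₁ : ℝ) + 1) = 2 * (w ^ 2 * n₁) + w ^ 2 := by ring
  have e2 : w ^ 2 * ((n₂ : ℝ) + n₁) = w ^ 2 * n₂ + w ^ 2 * n₁ := by ring
  have e3 : w ^ 2 * (2 * (n₁ : ℝ)) = 2 * (w ^ 2 * n₁) := by ring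
  have e4 : w ^ 2 * ((n₁ : ℝ) + 1) = w ^ 2 * n₁ + w ^ 2 := by ring
  have hn₁1 : 1 / 8 ≤ w ^ 2 * n₁ := by linarith only [hn1, a1, e1, e2, hw2]
  have hn₁3 : w ^ 2 * n₁ ≤ 1 / 2 := by linarith only [hn2, a2, e2, e3]
  have hn₁2 : w ^ 2 * n₁ ≤ 1 := by linarith only [hn₁3]
  have hn₂1 : 1 / 8 ≤ w ^ 2 * n₂ := by linarith only [hn₁1, a3]
  have hn₂2 : w ^ 2 * n₂ ≤ 1 := by
    have : 0 ≤ w ^ 2 * n₁ := by positivity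
    linarith only [hn2, e2, this]
  have hwn₁ : 1 / 8 ≤ w * n₁ := by
    have : w ^ 2 * n₁ ≤ w * n₁ := by
      have := mul_le_mul_of_nonneg_right hw1 (by positivity : (0:ℝ) ≤ w * n₁)
      nlinarith only [this]
    linarith only [hn₁1, this]
  have hwn₂ : 1 / 8 ≤ w * n₂ := by
    have : w ^ 2 * n₂ ≤ w * n₂ := by
      have := mul_le_mul_of_nonneg_right hw1 (by positivity : (0:ℝ) ≤ w * n₂)
      nlinarith only [this]
    linarith only [hn₂1, this]
  -- `1/(w√k) ≤ 2√2` when `w²k ≥ 1/8`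
  have hinv : ∀ k : ℕ, 1 / 8 ≤ w ^ 2 * k → 1 / (w * Real.sqrt k) ≤ 2 * Real.sqrt 2 := by
    intro k hk
    have hk0 : (0:ℝ) < k := by
      by_contra h; push Not at h
      have : w ^ 2 * k ≤ 0 := mul_nonpos_of_nonneg_of_nonpos (sq_nonneg _) h
      linarith
    have hws : 0 < w * Real.sqrt k := by positivity
    rw [div_le_iff₀ hws]
    have h2 : Real.sqrt 2 * Real.sqrt 2 = 2 := Real.mul_self_sqrt (by norm_num)
    have h3 : (w * Real.sqrt k) ^ 2 = w ^ 2 * k := by rw [mul_pow, Real.sq_sqrt hk0.le]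
    -- `(2√2 · w√k)² = 8 w²k ≥ 1`
    have h4 : 1 ≤ (2 * Real.sqrt 2 * (w * Real.sqrt k)) ^ 2 := by
      have e : (2 * Real.sqrt 2 * (w * Real.sqrt k)) ^ 2 = 4 * (Real.sqrt 2 * Real.sqrt 2) * (w * Real.sqrt k) ^ 2 := by ring
      rw [e, h2, h3]; linarith only [hk]
    have h5 : 0 ≤ 2 * Real.sqrt 2 * (w * Real.sqrt k) := by positivity
    nlinarith only [h4, h5]
  -- the test function of the first half: `F(y) = 𝔼_y u(X_{n₂})`
  set μ₁ := (Measure.pi fun _ : Fin n₁ => ρB) with hμ₁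
  set μ₂ := (Measure.pi fun _ : Fin n₂ => ρB) with hμ₂
  set F : ℝ → ℝ := fun y => ∫ B, u (ahPhase w y (finExt B) n₂) ∂μ₂ with hF
  obtain ⟨hFc, hFper⟩ := expect_continuous hτ hρ hw0 hwpc huc huper n₂
  have hF0 : ∀ y, 0 ≤ F y := fun y => integral_nonneg fun B => hu0 _
  set IF : ℝ := ∫ y in Set.Ico (0:ℝ) 1, u y with hIF
  have hIF0 : 0 ≤ IF := setIntegral_nonneg measurableSet_Ico fun y _ => hu0 y
  have hIF01 : ∫ y in (0:ℝ)..1, u y = IF := by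
    rw [intervalIntegral.integral_of_le zero_le_one, hIF, integral_Ico_eq_integral_Ioc]
  -- upper bound (5.1) with `h ≡ 0`: `F ≤ A₀ ∫ u`
  have hFA : ∀ y, F y ≤ A₀ * IF := by
    intro y
    have h := (hup w hwwu u huc huper hu0 y n₂ hwn₂ hn₂2).2
    simp only [zero_mul, Finset.sum_const_zero, mul_zero, Real.exp_zero, one_mul] at h
    refine h.trans ?_
    rw [hA₀, show Ku / (w * Real.sqrt n₂) = Ku * (1 / (w * Real.sqrt n₂)) by ring]
    have h1 := mul_le_mul_of_nonneg_left (hinv n₂ hn₂1) hKu.le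
    have h2 := mul_le_mul_of_nonneg_right h1 hIF0
    have e : 2 * Real.sqrt 2 * Ku * IF = Ku * (2 * Real.sqrt 2) * IF := by ring
    linarith only [h2, e]
  have hFabs : ∀ y, |F y| ≤ A₀ * IF := fun y => by rw [abs_of_nonneg (hF0 y)]; exact hFA y
  -- `∫_0^1 F ≥ r ∫ u` (uniform start) and `∫_0^1 F ≤ A₀ ∫ u`
  have hJlo : r * IF ≤ ∫ y in (0:ℝ)..1, F y := by
    have h1 := hus w hwws n₂ u huc huper hu0
    rw [hIF01] at h1
    have ht := hCsw w hwws
    have h2 : r ≤ (1 - Cs * w ^ 2) ^ n₂ := by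
      refine le_trans ?_ (exp_neg_le_one_sub_pow (by positivity) ht n₂)
      rw [hr, Real.exp_le_exp, neg_le_neg_iff]
      have : Cs * (w ^ 2 * n₂) ≤ Cs * 1 := mul_le_mul_of_nonneg_left hn₂2 hCs0
      have e : 2 * (Cs * w ^ 2) * (n₂ : ℝ) = 2 * (Cs * (w ^ 2 * n₂)) := by ring
      linarith only [this, e]
    calc r * IF ≤ (1 - Cs * w ^ 2) ^ n₂ * IF := mul_le_mul_of_nonneg_right h2 hIF0
      _ ≤ ∫ y in (0:ℝ)..1, F y := h1
  have hJhi : ∫ y in (0:ℝ)..1, F y ≤ A₀ * IF := by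
    calc ∫ y in (0:ℝ)..1, F y ≤ ∫ _y in (0:ℝ)..1, A₀ * IF :=
          intervalIntegral.integral_mono_on zero_le_one (hFc.intervalIntegrable _ _) intervalIntegrable_const
            fun y _ => hFA y
      _ = A₀ * IF := by simp
  have hJ0 : 0 ≤ ∫ y in (0:ℝ)..1, F y := le_trans (by positivity) hJlo
  -- the Markov split
  obtain ⟨M, hM0, hM⟩ := exists_bound_of_periodic' huc huper
  have hmarkov : ∫ B, u (ahPhase w x (finExt B) (n₂ + n₁)) ∂(Measure.pi fun _ : Fin (n₂ + n₁) => ρB) =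
      ∫ B, F (ahPhase w x (finExt B) n₁) ∂μ₁ := markov_split ρB huc.measurable hM w n₂ n₁ x
  -- the smoothing inequality for the law of `X^x_{n₁}`
  set V : ℝ≥0 := ⟨3 / 8 * σ2 * w ^ 2 * n₁, by positivity⟩ with hV
  have hVcoe : (V : ℝ) = 3 / 8 * σ2 * w ^ 2 * n₁ := rfl
  have hVne : V ≠ 0 := by
    intro h0
    have : (V : ℝ) = 0 := by rw [h0]; rfl
    rw [hVcoe] at this
    have : 0 < 3 / 8 * σ2 * w ^ 2 * n₁ := by nlinarith
    linarith
  set ε₀ : ℝ := C₁ * Real.exp (-(c / w)) / w with hε₀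
  have hε₀0 : 0 ≤ ε₀ := by positivity
  have htrans : ∀ φ : ℝ → ℝ, Continuous φ → Function.Periodic φ 1 → ∀ Aφ : ℝ, (∀ y, |φ y| ≤ Aφ) →
      ∀ s ∈ Set.Icc (-(1/2):ℝ) (1/2), |∫ B, φ (ahPhase w x (finExt B) n₁) ∂μ₁ -
        ∫ B, φ (ahPhase w x (finExt B) n₁ - s) ∂μ₁| ≤ Aφ * (C₁' * |s| + ε₀) := by
    intro φ hφc _ Aφ hAφ s _
    have hAφ0 : 0 ≤ Aφ := (abs_nonneg _).trans (hAφ 0)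
    refine (htr w hwwt φ hφc Aφ hAφ s x n₁ hwn₁ hn₁2).trans ?_
    refine mul_le_mul_of_nonneg_left ?_ hAφ0
    have h1 : C₁ * |s| / (w * Real.sqrt n₁) ≤ C₁' * |s| := by
      rw [show C₁ * |s| / (w * Real.sqrt n₁) = C₁ * |s| * (1 / (w * Real.sqrt n₁)) by ring, hC₁']
      have := mul_le_mul_of_nonneg_left (hinv n₁ hn₁1) (by positivity : (0:ℝ) ≤ C₁ * |s|)
      have e : 2 * Real.sqrt 2 * C₁ * |s| = C₁ * |s| * (2 * Real.sqrt 2) := by ring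
      linarith only [this, e]
    have h2 : C₁ * Real.exp (-(c / w)) / w = ε₀ := rfl
    linarith
  have hfreq : ∀ k k' : ℕ, k < m → k' < m →
      |∫ B, Real.cos (2 * π * ((k : ℝ) - k') * ahPhase w x (finExt B) n₁) ∂μ₁ -
        Real.exp (-(2 * π ^ 2 * ((k : ℝ) - k') ^ 2 * V)) * Real.cos (2 * π * ((k : ℝ) - k') * (x + n₁ * ahTheta w))| ≤ Cc' * w ∧
      |∫ B, Real.sin (2 * π * ((k : ℝ) - k') * ahPhase w x (finExt B) n₁) ∂μ₁ -
        Real.exp (-(2 * π ^ 2 * ((k : ℝ) - k') ^ 2 * V)) * Real.sin (2 * π * ((k : ℝ) - k') * (x + n₁ * ahTheta w))| ≤ Cc' * w := by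
    intro k k' hk hk'
    have hθ : |2 * π * ((k : ℝ) - k')| ≤ 2 * π * m := by
      rw [abs_mul, abs_of_pos (by positivity : (0:ℝ) < 2 * π)]
      refine mul_le_mul_of_nonneg_left ?_ (by positivity)
      have hk1 : (k : ℝ) ≤ m := by exact_mod_cast hk.le
      have hk2 : (k' : ℝ) ≤ m := by exact_mod_cast hk'.le
      rw [abs_le]; constructor <;> linarith [(Nat.cast_nonneg k : (0:ℝ) ≤ k), (Nat.cast_nonneg k' : (0:ℝ) ≤ k')]
    obtain ⟨h1, h2⟩ := hclt w hwwc (2 * π * ((k : ℝ) - k')) hθ x n₁ hn₁2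
    have e : Real.exp (-((2 * π * ((k : ℝ) - k')) ^ 2 * (3 / 8 * bM2 ρB * w ^ 2 * n₁) / 2)) =
        Real.exp (-(2 * π ^ 2 * ((k : ℝ) - k') ^ 2 * V)) := by
      rw [hVcoe, hσ2]; congr 1; ring
    rw [e] at h1 h2
    have hCw : Cc * w ≤ Cc' * w := mul_le_mul_of_nonneg_right (le_abs_self _) hw0.le
    exact ⟨h1.trans hCw, h2.trans hCw⟩
  have hsm := smoothing_lower_bound μ₁ (measurable_ahPhase_pi w x n₁) hVne (a := x + n₁ * ahTheta w)
    (δ := Cc' * w) (C₁ := C₁') (ε₀ := ε₀) hm0 (by positivity) htrans (fun k k' hk hk' => (hfreq k k' hk hk').1)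
    (fun k k' hk hk' => (hfreq k k' hk hk').2) hFc hFper hF0 hFA hC₁'0.le
  -- the Gaussian constant on the window
  have hgV : gm ≤ gaussLower V := by
    refine gaussLower_ge hVm0 ?_ ?_
    · rw [hVcoe, hVm]
      have := mul_le_mul_of_nonneg_left hn₁1 hσ.le
      have e : 3 / 8 * σ2 * w ^ 2 * (n₁ : ℝ) = 3 / 8 * (σ2 * (w ^ 2 * n₁)) := by ring
      linarith only [this, e]
    · rw [hVcoe, hVp]
      have := mul_le_mul_of_nonneg_left hn₁3 hσ.le
      have e : 3 / 8 * σ2 * w ^ 2 * (n₁ : ℝ) = 3 / 8 * (σ2 * (w ^ 2 * n₁)) := by ring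
      linarith only [this, e]
  -- smallness of the three losses
  have hloss1 : 2 * m * (Cc' * w) * (A₀ * IF) ≤ gm * r / 16 * IF := by
    have h1 : w * (32 * m * Cc' * A₀ + 1) ≤ gm * r := by rwa [hwa, le_div_iff₀ (by positivity)] at hwwa
    have e1 : w * (32 * m * Cc' * A₀ + 1) = 16 * (2 * m * Cc' * A₀ * w) + w := by ring
    have h2 : 2 * m * Cc' * A₀ * w ≤ gm * r / 16 := by linarith only [h1, e1, hw0.le]
    have h3 := mul_le_mul_of_nonneg_right h2 hIF0
    have e2 : 2 * m * (Cc' * w) * (A₀ * IF) = 2 * m * Cc' * A₀ * w * IF := by ring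
    linarith only [h3, e2]
  have hloss2 : A₀ * IF * (C₁' / Real.sqrt m) ≤ gm * r / 16 * IF := by
    have h1 := mul_le_mul_of_nonneg_right hbm hIF0
    have e : A₀ * IF * (C₁' / Real.sqrt m) = A₀ * (C₁' / Real.sqrt m) * IF := by ring
    linarith only [h1, e]
  have hloss3 : A₀ * IF * ε₀ ≤ gm * r / 16 * IF := by
    have h1 : ε₀ ≤ C₁ * (2 * w / c ^ 2) := by
      rw [hε₀, mul_div_assoc]
      exact mul_le_mul_of_nonneg_left (exp_neg_div_div_le hc hw0) hC₁.le
    have h2 : w * (32 * A₀ * C₁ + 1) ≤ gm * r * c ^ 2 := by rwa [hwbdef, le_div_iff₀ (by positivity)] at hwwb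
    have e2 : w * (32 * A₀ * C₁ + 1) = 16 * (2 * A₀ * C₁ * w) + w := by ring
    have h3 : A₀ * (C₁ * (2 * w / c ^ 2)) ≤ gm * r / 16 := by
      rw [show A₀ * (C₁ * (2 * w / c ^ 2)) = (2 * A₀ * C₁ * w) / c ^ 2 by ring, div_le_iff₀ (by positivity)]
      have e3 : gm * r / 16 * c ^ 2 = (gm * r * c ^ 2) / 16 := by ring
      linarith only [h2, e2, e3, hw0.le]
    have h4 : A₀ * IF * ε₀ ≤ A₀ * IF * (C₁ * (2 * w / c ^ 2)) := mul_le_mul_of_nonneg_left h1 (by positivity)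
    have h5 := mul_le_mul_of_nonneg_right h3 hIF0
    have e : A₀ * IF * (C₁ * (2 * w / c ^ 2)) = A₀ * (C₁ * (2 * w / c ^ 2)) * IF := by ring
    linarith only [h4, h5, e]
  -- assembling
  rw [hmarkov]
  set J : ℝ := ∫ y in (0:ℝ)..1, F y with hJ
  set EF : ℝ := ∫ B, F (ahPhase w x (finExt B) n₁) ∂μ₁ with hEF
  have hmain : (gaussLower V - 2 * m * (Cc' * w)) * J - A₀ * IF * (C₁' / Real.sqrt m + ε₀) ≤ EF := hsm
  have ha : gm * (r * IF) ≤ gaussLower V * J :=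
    mul_le_mul hgV hJlo (by positivity) ((hgm0.le).trans hgV)
  have hb : 2 * m * (Cc' * w) * J ≤ 2 * m * (Cc' * w) * (A₀ * IF) := mul_le_mul_of_nonneg_left hJhi (by positivity)
  have e1 : (gaussLower V - 2 * m * (Cc' * w)) * J = gaussLower V * J - 2 * m * (Cc' * w) * J := by ring
  have e2 : A₀ * IF * (C₁' / Real.sqrt m + ε₀) = A₀ * IF * (C₁' / Real.sqrt m) + A₀ * IF * ε₀ := by ring
  have e3 : gm * (r * IF) = gm * r * IF := by ring
  have h0 : 0 ≤ gm * r * IF := by positivity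
  have e4 : gm * r / 4 * IF = (gm * r * IF) / 4 := by ring
  have e5 : gm * r / 16 * IF = (gm * r * IF) / 16 := by ring
  linarith only [hmain, ha, hb, hloss1, hloss2, hloss3, e1, e2, e3, e4, e5, h0]

/-! ### From continuous to measurable test functions: reverse domination on the circle -/

/-- **Reverse domination from continuous test functions**: if `K ∫_{[0,1)} φ ≤ ∫ φ(X) dμ` for all
continuous `1`-periodic `φ ≥ 0`, then `K ∫⁻_{[0,1)} u ≤ ∫⁻ u(X) dμ` for every measurable `1`-periodic
`u : ℝ → [0,∞]` (Lebesgue measure on `ℝ/ℤ` is dominated by `K⁻¹ ×` the law of `X mod 1`).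
[folklore] -/
theorem periodic_density_lower {Ω : Type*} [MeasurableSpace Ω] (μ : Measure Ω) [IsFiniteMeasure μ]
    {X : Ω → ℝ} (hX : Measurable X) {K : ℝ} (hK : 0 < K)
    (hcont : ∀ φ : ℝ → ℝ, Continuous φ → Function.Periodic φ 1 → (∀ y, 0 ≤ φ y) →
      Integrable (fun ω => φ (X ω)) μ ∧ K * ∫ y in Set.Ico (0:ℝ) 1, φ y ≤ ∫ ω, φ (X ω) ∂μ) :
    ∀ u : ℝ → ℝ≥0∞, Measurable u → Function.Periodic u 1 →
      ENNReal.ofReal K * ∫⁻ y in Set.Ico (0:ℝ) 1, u y ≤ ∫⁻ ω, u (X ω) ∂μ := by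
  set πX : Ω → UnitAddCircle := fun ω => ((X ω : ℝ) : UnitAddCircle) with hπX
  have hπXm : Measurable πX := AddCircle.measurable_mk'.comp hX
  set mT : Measure UnitAddCircle := μ.map πX with hmT
  haveI : IsFiniteMeasure mT := Measure.isFiniteMeasure_map μ πX
  have hkey : ∀ g : UnitAddCircle → ℝ≥0∞, Measurable g → ∫⁻ z, g z ∂mT = ∫⁻ ω, g (πX ω) ∂μ := by
    intro g hg
    rw [hmT, lintegral_map hg hπXm]
  have hcircle : ∀ u : ℝ → ℝ≥0∞, Measurable u → (hu : Function.Periodic u 1) →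
      ∫⁻ y in Set.Ico (0:ℝ) 1, u y = ∫⁻ z, hu.lift z ∂volume := by
    intro u hum hu
    rw [← UnitAddCircle.lintegral_preimage 0 hu.lift]
    simp only [Function.Periodic.lift_coe, zero_add]
    exact setLIntegral_congr MeasureTheory.Ico_ae_eq_Ioc
  -- Lebesgue measure on the circle is dominated by `K⁻¹ mT`
  have hdom : (volume : Measure UnitAddCircle) ≤ ENNReal.ofReal (1 / K) • mT := by
    refine measure_le_smul_of_forall_lintegral_le volume mT ENNReal.ofReal_ne_top fun f => ?_
    set φ : ℝ → ℝ := fun y => ((f ((y : ℝ) : UnitAddCircle) : ℝ≥0) : ℝ) with hφ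
    have hφc : Continuous φ := NNReal.continuous_coe.comp (f.continuous.comp (AddCircle.continuous_mk' 1))
    have hφper : Function.Periodic φ 1 := fun y => by
      simp only [hφ]; rw [AddCircle.coe_add_period]
    have hφ0 : ∀ y, 0 ≤ φ y := fun y => NNReal.coe_nonneg _
    obtain ⟨hint, hle⟩ := hcont φ hφc hφper hφ0
    have hfm : Measurable fun z : UnitAddCircle => (f z : ℝ≥0∞) := f.continuous.measurable.coe_nnreal_ennreal
    -- left-hand side
    have hlhs : ∫⁻ z, (f z : ℝ≥0∞) ∂volume = ENNReal.ofReal (∫ y in Set.Ico (0:ℝ) 1, φ y) := by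
      have hφi : IntegrableOn φ (Set.Ico (0:ℝ) 1) := hφc.integrableOn_Icc.mono_set Set.Ico_subset_Icc_self
      rw [ofReal_integral_eq_lintegral_ofReal hφi (ae_of_all _ fun y => hφ0 y)]
      have hper' : Function.Periodic (fun y => ENNReal.ofReal (φ y)) 1 := fun y => by
        simp only [hφper y]
      have := hcircle (fun y => ENNReal.ofReal (φ y)) (ENNReal.measurable_ofReal.comp hφc.measurable) hper'
      rw [this]
      refine lintegral_congr fun z => ?_
      induction z using QuotientAddGroup.induction_on with
      | H y => rw [Function.Periodic.lift_coe]; simp only [hφ, ENNReal.ofReal_coe_nnreal]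
    -- right-hand side
    have hrhs : ∫⁻ z, (f z : ℝ≥0∞) ∂mT = ENNReal.ofReal (∫ ω, φ (X ω) ∂μ) := by
      rw [hkey _ hfm, ofReal_integral_eq_lintegral_ofReal hint (ae_of_all _ fun ω => hφ0 _)]
      refine lintegral_congr fun ω => ?_
      simp only [hφ, hπX, ENNReal.ofReal_coe_nnreal]
    rw [hlhs, hrhs, ← ENNReal.ofReal_mul (by positivity)]
    refine ENNReal.ofReal_le_ofReal ?_
    rw [one_div, ← div_eq_inv_mul, le_div_iff₀ hK, mul_comm]
    exact hle
  -- conclusion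
  intro u hum hu
  have hliftm : Measurable (hu.lift : UnitAddCircle → ℝ≥0∞) :=
    QuotientAddGroup.measurable_from_quotient.mpr hum
  have h1 : ∫⁻ y in Set.Ico (0:ℝ) 1, u y ≤ ENNReal.ofReal (1 / K) * ∫⁻ ω, u (X ω) ∂μ := by
    calc ∫⁻ y in Set.Ico (0:ℝ) 1, u y = ∫⁻ z, hu.lift z ∂volume := hcircle u hum hu
      _ ≤ ∫⁻ z, hu.lift z ∂(ENNReal.ofReal (1 / K) • mT) := lintegral_mono' hdom le_rfl
      _ = ENNReal.ofReal (1 / K) * ∫⁻ ω, u (X ω) ∂μ := by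
          rw [lintegral_smul_measure, hkey _ hliftm, smul_eq_mul]
          congr 1
  calc ENNReal.ofReal K * ∫⁻ y in Set.Ico (0:ℝ) 1, u y
      ≤ ENNReal.ofReal K * (ENNReal.ofReal (1 / K) * ∫⁻ ω, u (X ω) ∂μ) := mul_le_mul_right h1 _
    _ = ∫⁻ ω, u (X ω) ∂μ := by
        rw [← mul_assoc, ← ENNReal.ofReal_mul hK.le, mul_one_div_cancel hK.ne', ENNReal.ofReal_one, one_mul]

/-- **Prop. 5.1, lower bound (5.2), `h ≡ 0`** — the second conjunct of
`AjankiHuveneers2011_potentialTheory` for the zero tilt, verbatim: there are `K', w₀ > 0` such that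
for `0 < w ≤ w₀`, every `1`-periodic `u ≥ 0` integrable on `[0,1)`, every `x` and every `n` with
`1/2 ≤ w²n ≤ 1`, the expectation `𝔼 u(X^x_n)` is finite and `≥ K' ∫_{[0,1)} u`.
[cite: AjankiHuveneers2011, Prop. 5.1 eq. (5.2)] -/
theorem potentialTheory_lower_zero (τ : ℝ → ℝ) (bm bp : ℝ) (hτ : ReducedLawHyp τ bm bp)
    (ρB : Measure ℝ) [IsProbabilityMeasure ρB]
    (hρ : ρB = volume.withDensity fun s => ENNReal.ofReal (τ s)) :
    ∃ K' w₀ : ℝ, 0 < K' ∧ 0 < w₀ ∧ ∀ w ∈ Set.Ioc 0 w₀,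
      ∀ u : ℝ → ℝ, Function.Periodic u 1 → (∀ y, 0 ≤ u y) → IntegrableOn u (Set.Ico 0 1) →
        ∀ x : ℝ, ∀ n : ℕ, 1 / 2 ≤ w ^ 2 * n → w ^ 2 * n ≤ 1 →
          Integrable (fun B : Fin n → ℝ =>
              Real.exp (w * ∑ k ∈ Finset.range n, (fun _ : ℝ => (0:ℝ)) (ahPhase w x (finExt B) k) * finExt B k) *
                u (ahPhase w x (finExt B) n)) (Measure.pi fun _ : Fin n => ρB) ∧
          K' * ∫ y in Set.Ico 0 1, u y ≤
            ∫ B, Real.exp (w * ∑ k ∈ Finset.range n, (fun _ : ℝ => (0:ℝ)) (ahPhase w x (finExt B) k) * finExt B k) *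
              u (ahPhase w x (finExt B) n) ∂(Measure.pi fun _ : Fin n => ρB) := by
  obtain ⟨K', wl, hK', hwl, hlow⟩ := potential_lower_continuous hτ ρB hρ
  obtain ⟨Ku, wu, hKu, hwu, hup⟩ := potentialTheory_upper τ bm bp hτ ρB hρ (1 / 2) (by norm_num)
    (fun _ => (0:ℝ)) (fun _ => rfl) contDiff_const
  refine ⟨K', min (min wl wu) 1, hK', lt_min (lt_min hwl hwu) one_pos, ?_⟩
  intro w hw u huper hu0 huint x n hn1 hn2
  obtain ⟨hw0, hwle⟩ := hw
  have hwwl : w ∈ Set.Ioc 0 wl := ⟨hw0, hwle.trans ((min_le_left _ _).trans (min_le_left _ _))⟩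
  have hwwu : w ∈ Set.Ioc 0 wu := ⟨hw0, hwle.trans ((min_le_left _ _).trans (min_le_right _ _))⟩
  have hw1 : w ≤ 1 := hwle.trans (min_le_right _ _)
  have hκn : 1 / 2 ≤ w * n := by
    have : w ^ 2 * n ≤ w * n := by
      have := mul_le_mul_of_nonneg_right hw1 (by positivity : (0:ℝ) ≤ w * n)
      nlinarith only [this]
    linarith only [hn1, this]
  set μ := (Measure.pi fun _ : Fin n => ρB) with hμ
  set X : (Fin n → ℝ) → ℝ := fun B => ahPhase w x (finExt B) n with hX
  have hXm : Measurable X := measurable_ahPhase_pi w x n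
  -- the weight is `1`
  have hE1 : ∀ B : Fin n → ℝ,
      Real.exp (w * ∑ k ∈ Finset.range n, (fun _ : ℝ => (0:ℝ)) (ahPhase w x (finExt B) k) * finExt B k) = 1 := by
    intro B; simp
  -- integrability from the upper bound
  obtain ⟨hint, -⟩ := hup w hwwu u huper hu0 huint x n hκn hn2
  refine ⟨hint, ?_⟩
  have hIu : Integrable (fun B => u (X B)) μ := by
    have := hint; simp only [hE1, one_mul] at this; exact this
  -- a measurable periodic modification `v` of `u`, and `u(X) = v(X)` a.s. (upper bound applied to `|u - v|`)
  obtain ⟨v, hvm, hvper, hv0, hae, N, hNm, hN0, hagree⟩ := exists_measurable_periodic_modification hu0 huint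
  have hvint : IntegrableOn v (Set.Ico 0 1) := huint.congr hae
  have hintv : ∫ y in Set.Ico (0:ℝ) 1, u y = ∫ y in Set.Ico (0:ℝ) 1, v y := integral_congr_ae hae
  set d : ℝ → ℝ := fun y => |u y - v y| with hd
  have hdper : Function.Periodic d 1 := fun y => by simp only [hd, huper y, hvper y]
  have hd0 : ∀ y, 0 ≤ d y := fun y => abs_nonneg _
  have hdint : IntegrableOn d (Set.Ico 0 1) := (huint.sub hvint).abs
  have hd_zero : ∫ y in Set.Ico (0:ℝ) 1, d y = 0 := by
    have : d =ᵐ[volume.restrict (Set.Ico 0 1)] 0 := by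
      filter_upwards [hae] with y hy
      simp only [hd, hy, sub_self, abs_zero, Pi.zero_apply]
    rw [integral_congr_ae this]; simp
  obtain ⟨hdI, hdle⟩ := hup w hwwu d hdper hd0 hdint x n hκn hn2
  simp only [hE1, one_mul] at hdI hdle
  rw [hd_zero, mul_zero] at hdle
  have hd_ae : (fun B => d (X B)) =ᵐ[μ] 0 := by
    have h0 : ∫ B, d (X B) ∂μ = 0 := le_antisymm hdle (integral_nonneg fun B => hd0 _)
    exact (integral_eq_zero_iff_of_nonneg (fun B => hd0 _) hdI).mp h0
  have haeX : (fun B => u (X B)) =ᵐ[μ] fun B => v (X B) := by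
    filter_upwards [hd_ae] with B hB
    have : |u (X B) - v (X B)| = 0 := hB
    exact sub_eq_zero.mp (abs_eq_zero.mp this)
  have hIv : Integrable (fun B => v (X B)) μ := hIu.congr haeX
  -- the lower bound for `v` through the reverse domination
  have hcont : ∀ φ : ℝ → ℝ, Continuous φ → Function.Periodic φ 1 → (∀ y, 0 ≤ φ y) →
      Integrable (fun B => φ (X B)) μ ∧ K' * ∫ y in Set.Ico (0:ℝ) 1, φ y ≤ ∫ B, φ (X B) ∂μ := by
    intro φ hφc hφper hφ0
    obtain ⟨M, hM0, hM⟩ := exists_bound_of_periodic' hφc hφper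
    refine ⟨Integrable.mono' (integrable_const M) ((hφc.measurable.comp hXm).aestronglyMeasurable)
      (ae_of_all _ fun B => by rw [Real.norm_eq_abs]; exact hM _), ?_⟩
    exact hlow w hwwl φ hφc hφper hφ0 x n hn1 hn2
  have hlin := periodic_density_lower μ hXm hK' hcont (fun y => ENNReal.ofReal (v y))
    (ENNReal.measurable_ofReal.comp hvm) (fun y => by simp only [hvper y])
  have hlhs : ∫⁻ y in Set.Ico (0:ℝ) 1, ENNReal.ofReal (v y) = ENNReal.ofReal (∫ y in Set.Ico (0:ℝ) 1, v y) :=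
    (ofReal_integral_eq_lintegral_ofReal hvint (ae_of_all _ fun y => hv0 y)).symm
  have hrhs : ∫⁻ B, ENNReal.ofReal (v (X B)) ∂μ = ENNReal.ofReal (∫ B, v (X B) ∂μ) :=
    (ofReal_integral_eq_lintegral_ofReal hIv (ae_of_all _ fun B => hv0 _)).symm
  rw [hlhs, hrhs, ← ENNReal.ofReal_mul hK'.le] at hlin
  have hle : K' * ∫ y in Set.Ico (0:ℝ) 1, v y ≤ ∫ B, v (X B) ∂μ :=
    (ENNReal.ofReal_le_ofReal_iff (integral_nonneg fun B => hv0 _)).mp hlin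
  -- back to `u`
  have hgoal : ∫ B, Real.exp (w * ∑ k ∈ Finset.range n, (fun _ : ℝ => (0:ℝ)) (ahPhase w x (finExt B) k) * finExt B k) *
      u (ahPhase w x (finExt B) n) ∂μ = ∫ B, u (X B) ∂μ := by
    refine integral_congr_ae (ae_of_all _ fun B => ?_)
    show Real.exp (w * ∑ k ∈ Finset.range n, (fun _ : ℝ => (0:ℝ)) (ahPhase w x (finExt B) k) * finExt B k) *
      u (ahPhase w x (finExt B) n) = u (X B)
    have := hE1 B
    simp only [hX]
    simp
  rw [hgoal, integral_congr_ae haeX, hintv]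
  exact hle

end Literature.Barriers.AtomisticToContinuum.HeatConduction

end
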